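import Summits.QuantumFields.BalabanUV.T4Continuum.Support.VariationalVectorEndOfLeavesSlice
import Summits.QuantumFields.BalabanUV.T4Continuum.Support.VariationalVectorGaugeSliceUB
import Summits.QuantumFields.BalabanUV.T4Continuum.Support.VariationalVectorGaugeSliceFED

/-!
# T⁴ programme, spine node NE2 (U1a), lane P2 — THE VECTOR END AT `U = 1`, ASSEMBLED: the slice END (p221732) at flat data with BAŁABAN's gauge
# functional `G k = projG 1 (ker Q′_1)`, thirteen of its fifteen sockets DISCHARGED BY NAME, leaves V-ONE (slice′) and V-REG DISPLAYED — model level, `E = ℂ`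

NE2 formalisation swarm `b2b-balaban-t4-ne2-formalise-*`, leaf prover 10 GEN 3 (`prover-b2b-balaban-t4-ne2-formalise-leaf-10-g3-0`, V-END holder lineage);
journal INTENT CLAIMS.log l.15875 «THE U = 1 VECTOR END, ASSEMBLED» (answering leaf-09-g7 l.15612 ∕ l.15767).  Typer `t4/formal/NE2/LEAVES.md` v1.24a,
register P2-sup.  A COMPOSITION FILE: no new estimate, no `def`; every input is a landed module consumed BY NAME —
 * the slice END `VariationalVectorEndOfLeavesSlice.towerLimitRate_effV_of_leaves_slice` (leaf-10-g3, p221732);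
 * leaf-09-g7's «V-GF AT U = 1» files 1–4, 6, 7 (`VariationalVectorGaugeSlice{,Flat,B5,Tower,UB,FED}`, p221888 ∕ p222324 ∕ p222476 ∕ p222627 ∕ p223319 ∕ p223421):
   the tower data `Gk`∕`Gk'`∕`Gmk` and the sockets `hGm_flat`, `hG_flat`, `hGtr_flat`, `hRtr_flat`, `hTcomp_flat`, `hPc_tower`, `hPf_tower`, `hslice_tower`
   (file 4), `hUBc_tower`, `hUBf_tower`, `hsurj₁_tower` (file 6, `Λ⋆ = lamV d 0 d 0`), `hFEDcurl_tower` (file 7, `δ = 0`, on leaf-01-g5's p218349).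

THE STATEMENT (model level; `E = ℂ`; flat data `R k = 1`, `R′ k = 1`, `T k = 1`, `T′ k = 1` along `n_k = L^k`; `1 ≤ d`).
 * §1 `norm_one_le` (`hT′1`: the identity transport is a contraction);
 * §2 **`towerLimitRate_effV_flat`**: for `0 < a`, `0 ≤ θ < 1` and ANY regularity functional `ρV k ≥ 0` with displayed leaves
   V-ONE (`hONE`: `blockSpin (Q_1) (SfV 1 (Gk′ k)) W ≤ (√(ScV 1 (Gk k) W + ε₁ k·ρV k W) + δ′ k·√(qWV W))²`, `ε₁ k ≤ c_ε θ^k`, `δ′ k ≤ c_δ′ θ^k`) and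
   V-REG (`hREG`: fibre minimisers have `ρV k W ≤ C_R k·(ScV 1 (Gk k) W + nsqV φ)`, `C_R k ≤ C_R⋆`), the flat vector effective operators
   `X^V_k = effV (L^k) M 1 (Gmk L M k) (QmL (L^k) M 1) a` CONVERGE: `TowerLimitRate 1 1 X^V (eV Λ⋆ C_P⋆ 0 + ePV Λ⋆ C_P⋆ C_R⋆ c_ε c_δ′) θ` with
   `Λ⋆ = lamV d 0 d 0`, `C_P⋆ = (d+1)·Cst(d,1)` — i.e. `‖X^V_k − X^V_∞‖ ≤ C·θ^k∕(1−θ)`.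
WHY V-ONE STAYS DISPLAYED (located question → leaf-01 ∕ leaf-09 lineages; the same dimension count is leaf-09-g7's LOCATED REMARK «V-ONE-G AT U = 1», CLAIMS.log l.16041): with the fine form `SfV 1 (Gk′ k)` the one-step competitor must be near the FINE slice
`{projG_{L^{k+1}} = 0}`; inside the one-step fibre `{Q_L W′ = W}` only gauge moves by `λ ∈ ker Q′_L ⊊ ker Q′_{L^{k+1}}` are available and `Δ(ker Q′_L) ⊊ Δ(ker Q′_{L^{k+1}})`
for `k ≥ 1`, so file 2's slice one level up does NOT apply verbatim; what is needed is `projGf(W′) ≤ Gk(W) + ε₁·ρ(W)` for the interpolating competitor after the best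
one-step gauge move ([Balaban1984PropagatorsI] (1.23)'s composition identity, function world).  V-REG at `U = 1`: fibre minimisers satisfy `(I − PcT)·div_1 W₀ = 0`
(leaf-09-g7), the estimate itself is leaf-03-g5's «V-REG PROPER» line.

HONEST FRAMING (T4-DAG p. 1).  [folklore] composition at MODEL level of landed model-level modules; flat data = the free field, physically trivial — structurally the
NON-VACUITY certificate of thirteen of the END's fifteen sockets; nothing printed is a hypothesis; no `def`, no `sorry`; axioms standard.  No leaf WITH BACKGROUND is
discharged; V-ONE (slice′) and V-REG displayed even at flat data; V-GF ∕ V-REG with background OPEN; V-END ∕ NE2 NOT proved; NE3 OPEN; spine PROVED 0∕9 unchanged;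
rung (B)+1 finite T⁴ — NOT infinite volume, NOT mass gap, NOT Clay.  HONEST DEPENDENCY (cell, verbatim): continuum YM on T⁴ ⇐ BetaPertH ∧ nine spine estimates
(0/9 proved); BetaPertH ⇐ (D1) ∧ (D4) ∧ CAP+tail; G-an2-4 gates asym, D1 and NE2/3/4.
-/

noncomputable section

namespace Summit.QuantumFields.BalabanUV.T4Continuum.VariationalVectorEndFlat

open Finset
open scoped Matrix ComplexConjugate ComplexOrder
open Literature.MathematicalPhysics.QuantumFieldTheory.Balaban1983to89.B5Prop11Plancherel (Tor fine Cst Cst_nonneg)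
open Summit.QuantumFields.BalabanUV.T4Continuum.VariationalTransfer (blockSpin)
open Summit.QuantumFields.BalabanUV.T4Continuum.CovariantAveragingTower (TowerLimitRate)
open Summit.QuantumFields.BalabanUV.T4Continuum.VectorBlockTrialForm (nsqV QvL)
open Summit.QuantumFields.BalabanUV.T4Continuum.VariationalVectorForm (ScV SfV qWV lamV lamV_nonneg)
open Summit.QuantumFields.BalabanUV.T4Continuum.VariationalVectorEffective (unc effV)
open Summit.QuantumFields.BalabanUV.T4Continuum.VariationalVectorTower (QmL)
open Summit.QuantumFields.BalabanUV.T4Continuum.VariationalVectorEndOfLeaves (eV ePV towerLimitRate_effV_of_leaves_slice)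
open Summit.QuantumFields.BalabanUV.T4Continuum.VariationalVectorGaugeSliceB5 (flatR)
open Summit.QuantumFields.BalabanUV.T4Continuum.VariationalVectorGaugeSliceTower
  (Gk Gk' Gmk hGm_flat hG_flat hGtr_flat hRtr_flat hTcomp_flat hPc_tower hPf_tower hslice_tower)
open Summit.QuantumFields.BalabanUV.T4Continuum.VariationalVectorGaugeSliceUB (hUBc_tower hUBf_tower hsurj₁_tower)
open Summit.QuantumFields.BalabanUV.T4Continuum.VariationalVectorGaugeSliceFED (hFEDcurl_tower)

variable {d : ℕ} (L : ℕ) [NeZero L] (M : Fin d → ℕ) [hM : ∀ μ, NeZero (M μ)]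

/-! ## §1 The socket `hT′1` at flat data -/

omit [NeZero L] hM in
/-- `hT′1` at flat data: the identity transport is a contraction. [folklore] -/
theorem norm_one_le : ‖(1 : ℂ →L[ℂ] ℂ)‖ ≤ 1 := by
  rw [ContinuousLinearMap.one_def]
  exact ContinuousLinearMap.norm_id_le

/-! ## §2 The U = 1 vector END, assembled -/

/-- **THE VECTOR END AT `U = 1`, ASSEMBLED.**  Flat data along `n_k = L^k` with Bałaban's gauge functional `G k = projG 1 (ker Q′_1)` (leaf-09-g7's `Gk`,
matrices `Gmk`, pullbacks `Gk′`); thirteen of the fifteen sockets of the slice END (`hGm`, `hG`, `hTcomp`, `hRtr`, `hGtr`, `hT′1`, `hsurj₁`, `hUBc`, `hUBf`,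
`hPc`, `hPf`, `hFEDcurl`, `hslice`) discharged BY NAME (§1 and leaf-09-g7's files 4 ∕ 6 ∕ 7), with `δ = σ = σ′ = 0` and k-constant `Λ`, `C_P`; DISPLAYED: leaf V-ONE in the square-root
shape against the fine GAUGE form (`hONE`, small parameters `ε₁ k ≤ c_ε θ^k`, `δ′ k ≤ c_δ′ θ^k`) and leaf V-REG (`hREG`, `C_R k ≤ C_R⋆`) for a regularity
functional `ρV k ≥ 0`.  THEN `TowerLimitRate 1 1 (k ↦ effV (L^k) M 1 (Gmk L M k) (QmL (L^k) M 1) a) (eV Λ⋆ C_P⋆ 0 + ePV Λ⋆ C_P⋆ C_R⋆ c_ε c_δ′) θ`,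
`Λ⋆ = lamV d 0 d 0`, `C_P⋆ = (d+1)·Cst(d,1)`. [folklore] -/
theorem towerLimitRate_effV_flat (hd : 1 ≤ d) {a : ℝ} (ha : 0 < a) (CR ε₁ δ' : ℕ → ℝ) {CRs cε cδ' θ : ℝ}
    (hCR : ∀ k, 0 ≤ CR k) (hCRs : ∀ k, CR k ≤ CRs) (hε₁ : ∀ k, 0 ≤ ε₁ k) (hδ' : ∀ k, 0 ≤ δ' k) (hθ : 0 ≤ θ) (hθ1 : θ < 1)
    (hεθ : ∀ k, ε₁ k ≤ cε * θ ^ k) (hδ'θ : ∀ k, δ' k ≤ cδ' * θ ^ k)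
    {ρV : (k : ℕ) → (Tor (fine (L ^ k) M) → Fin d → ℂ) → ℝ} (hρ0 : ∀ k W, 0 ≤ ρV k W)
    (hONE : ∀ k W, blockSpin (QvL L (fine (L ^ k) M) (fun _ _ _ _ => (1 : ℂ →L[ℂ] ℂ))) (SfV (L ^ k) L M (flatR L (fine (L ^ k) M)) (Gk' L M k)) W
      ≤ (Real.sqrt (ScV (L ^ k) M (flatR (L ^ k) M) (Gk L M k) W + ε₁ k * ρV k W) + δ' k * Real.sqrt (qWV (L ^ k) M W)) ^ 2)
    (hREG : ∀ k (φ : Tor M → Fin d → ℂ) W, QvL (L ^ k) M (fun _ _ _ _ => (1 : ℂ →L[ℂ] ℂ)) W = φ →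
      (∀ W₂, QvL (L ^ k) M (fun _ _ _ _ => (1 : ℂ →L[ℂ] ℂ)) W₂ = φ →
        ScV (L ^ k) M (flatR (L ^ k) M) (Gk L M k) W ≤ ScV (L ^ k) M (flatR (L ^ k) M) (Gk L M k) W₂) →
      ρV k W ≤ CR k * (ScV (L ^ k) M (flatR (L ^ k) M) (Gk L M k) W + nsqV M φ)) :
    TowerLimitRate (ι := fun _ => Tor M × Fin d) (fun _ => (1 : Matrix (Tor M × Fin d) (Tor M × Fin d) ℂ)) 1
      (fun k => effV (L ^ k) M (flatR (L ^ k) M) (Gmk L M k) (QmL (L ^ k) M (fun _ _ _ _ => (1 : ℂ →L[ℂ] ℂ))) a)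
      (eV (lamV d 0 d 0) (((d : ℝ) + 1) * Cst d 1) 0 + ePV (lamV d 0 d 0) (((d : ℝ) + 1) * Cst d 1) CRs cε cδ') θ := by
  have hΛ0 : 0 ≤ lamV d 0 d 0 := lamV_nonneg (Nat.cast_nonneg d) le_rfl
  have hCP0 : 0 ≤ ((d : ℝ) + 1) * Cst d 1 := by have := Cst_nonneg d 1; positivity
  have h := towerLimitRate_effV_of_leaves_slice L M (fun k => flatR (L ^ k) M) (fun k => flatR L (fine (L ^ k) M)) (Gmk L M) (Gk L M) (Gk' L M)
    (fun k => fun _ _ _ _ => (1 : ℂ →L[ℂ] ℂ)) (fun k => fun _ _ _ _ => (1 : ℂ →L[ℂ] ℂ))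
    (hGm_flat L M) (hG_flat L M) (hTcomp_flat L M) (hRtr_flat L M) (hGtr_flat L M) (fun _ _ _ _ _ => norm_one_le) (hsurj₁_tower L M hd) ha
    (fun _ => lamV d 0 d 0) (fun _ => ((d : ℝ) + 1) * Cst d 1) CR (fun _ => 0) ε₁ δ' (fun _ => 0) (fun _ => 0)
    (Λs := lamV d 0 d 0) (CPs := ((d : ℝ) + 1) * Cst d 1) (CRs := CRs) (cδ := 0) (cε := cε) (cδ' := cδ') (cσ := 0) (cσ' := 0) (θ := θ)
    (fun _ => hΛ0) (fun _ => le_rfl) (fun _ => hCP0) (fun _ => le_rfl) hCR hCRs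
    (fun _ => le_rfl) hε₁ hδ' (fun _ => le_rfl) (fun _ => le_rfl) hθ hθ1
    (fun _ => by rw [zero_mul]) hεθ hδ'θ (fun _ => by rw [zero_mul]) (fun _ => by rw [zero_mul]) hρ0
    (hUBc_tower L M hd) (hUBf_tower L M hd) (hPc_tower L M) (hPf_tower L M) (hFEDcurl_tower L M) (hslice_tower L M) hONE hREG
  have e : eV (lamV d 0 d 0) (((d : ℝ) + 1) * Cst d 1) 0 + 0 * (lamV d 0 d 0 + eV (lamV d 0 d 0) (((d : ℝ) + 1) * Cst d 1) 0)
      + 0 * ((((d : ℝ) + 1) * Cst d 1) * (lamV d 0 d 0 + 1)) + ePV (lamV d 0 d 0) (((d : ℝ) + 1) * Cst d 1) CRs cε cδ'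
      = eV (lamV d 0 d 0) (((d : ℝ) + 1) * Cst d 1) 0 + ePV (lamV d 0 d 0) (((d : ℝ) + 1) * Cst d 1) CRs cε cδ' := by ring
  rw [e] at h
  exact h

end Summit.QuantumFields.BalabanUV.T4Continuum.VariationalVectorEndFlat

end
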